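import Summits.FinalStateConjecture.FinalStateConjecture.Theorems.BartnikGapSettlingBondiBartnikRigiditySlabCauchyRigidityDefs
import HarnessLib

/-!
# F1' `stub_slabCauchyRigidity'`, step (a): the factorisation of the collar chart through the
# Cauchy hypersurface on the open slab — line `direct-method-on-the-cone`, crux `BondiBartnikRigidity`
# (stmt-FinalStateConjecture-10807); module 5 of the landing of the conditional proof of F1'

The first input of route statement (A) `F1Route.SlabSubdatum` (`…SlabCauchyRigidityDefs.lean`),
PROVED here with its statement written out (no new `Prop` definition):

* `slabFactorisation_holds` — **(A1)**, step (a): the collar chart restricted to the open slab factors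
  smoothly through the embedded Cauchy hypersurface `ι(X)`: `Φ₀ ∘ (y ↦ Λ(0,y) + c) = ι ∘ Φ_N` with
  `Φ_N : slabW → X` smooth, with injective differentials and an open embedding
  (`Literature.Geometry.Manifold.exists_contMDiff_comp_eq_of_range_subset`; exactness at order `0`
  makes `dΦ₀` injective at slab points; `isLocalDiffeomorphAt_of_mfderiv`).

Also the small shared lemmas of the reduction (`range_ψN_eq`, `isOpen_diamondK`, `lab_poincareInv`,
`poincareInv_lab`, `poincareInv_injective`, `supCkENorm_zero_le_of_forall_eq_zero`,
`deviation_eq_zero_of_truncDeviationCk_le_zero`).  The metric identity (A2h) and the second-form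
identity (A2k) are the companion modules `…SlabCauchyRigidityMetricIdentity.lean`,
`…SlabCauchyRigiditySecondForm*.lean`.  Registered bookkeeping sub-goal of the line:
`stub_slabFactorisation` (= (A1)).

References: Lee, Introduction to Smooth Manifolds (2013), Cor. 5.30 [LeeSmoothManifolds2013];
O'Neill 1983, Ch. 4 [ONeill1983].  No definitions, no named facts.
-/

noncomputable section

-- D-0017: single-problem summit, `Summit.<S>.<S>.…` by design (cf. lakefile `weak.linter.dupNamespace`).
set_option linter.dupNamespace false
set_option maxSynthPendingDepth 3

open Set Filter Function Topology TopologicalSpace Bundle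
open Literature.Geometry.Lorentzian
open scoped Manifold ContDiff Topology ENNReal

namespace Summit.FinalStateConjecture.FinalStateConjecture.Theorems.BondiBartnikRigidity.DirectMethod

namespace F1Route

/-! ### Small shared lemmas -/

section Shared

/-- The image of the open slab under `ψ_N` is the Kerr-side open slab `slab°`. [folklore] -/
theorem range_ψN_eq (M a : ℝ) : range (ψN M a) = slabKo M a := by
  ext z
  constructor
  · rintro ⟨y, rfl⟩
    exact ψN_mem_slabKo M a y
  · rintro ⟨h0, hr⟩
    have hz : (z : E4) = E4.ofTimeSpace 0 (E4.spatial (z : E4)) := by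
      conv_lhs => rw [← E4.ofTimeSpace_time_spatial (z : E4)]
      rw [E4.time_apply, h0]
    have hmem : E4.spatial (z : E4) ∈ Kerr.slice a M := by
      show max M 0 < Kerr.radius a (E4.ofTimeSpace 0 (E4.spatial (z : E4)))
      rw [← hz]; exact z.2
    refine ⟨⟨⟨E4.spatial (z : E4), hmem⟩, ?_⟩, ?_⟩
    · show Kerr.radius a (E4.ofTimeSpace 0 (E4.spatial (z : E4))) < 3 * M
      rw [← hz]; exact hr
    · exact Subtype.ext hz.symm

/-- The Kerr-side corrected diamond is open in the star chart. [folklore] -/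
theorem isOpen_diamondK (M a : ℝ) : IsOpen (diamondK M a) := by
  have hr : Continuous fun y : Kerr.region a M => Kerr.radius a y.1 :=
    (Kerr.continuous_radius a).comp continuous_subtype_val
  have h0 : Continuous fun x : E4 => x 0 := PiLp.continuous_apply 2 _ 0
  have ht : Continuous fun y : Kerr.region a M => y.1 0 := h0.comp continuous_subtype_val
  simp only [diamondK, Set.setOf_and]
  refine (isOpen_lt continuous_const ?_).inter (isOpen_lt continuous_const ?_) <;> fun_prop

/-- `Λ (Λ⁻¹(x − c)) + c = x`. [folklore] -/
theorem lab_poincareInv (mo : lorentzGroup × E4) (x : E4) :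
    (mo.1 : E4 ≃L[ℝ] E4) (poincareInv mo.1 mo.2 x) + mo.2 = x := by
  simp [poincareInv]

/-- `Λ⁻¹((Λ z + c) − c) = z`. [folklore] -/
theorem poincareInv_lab (mo : lorentzGroup × E4) (z : E4) :
    poincareInv mo.1 mo.2 ((mo.1 : E4 ≃L[ℝ] E4) z + mo.2) = z := by
  simp [poincareInv]

/-- The rest-frame map `Λ⁻¹(· − c)` is injective. [folklore] -/
theorem poincareInv_injective (mo : lorentzGroup × E4) : Injective (poincareInv mo.1 mo.2) :=
  fun x y h => by rw [← lab_poincareInv mo x, ← lab_poincareInv mo y, h]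

/-- The `C⁰` sup norm of a function vanishing on `S` is `≤ 0`. [folklore] -/
theorem supCkENorm_zero_le_of_forall_eq_zero {F G : Type*} [NormedAddCommGroup F] [NormedSpace ℝ F]
    [NormedAddCommGroup G] [NormedSpace ℝ G] {S : Set F} {f : F → G} (h : ∀ x ∈ S, f x = 0) :
    supCkENorm S 0 f ≤ 0 := by
  refine iSup₂_le fun m hm ↦ iSup₂_le fun x hx ↦ ?_
  obtain rfl : m = 0 := Nat.le_zero.mp hm
  have h0 : iteratedFDeriv ℝ 0 f x = 0 := by
    ext v
    rw [iteratedFDeriv_zero_apply, h x hx]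
    rfl
  rw [h0, enorm_zero]

set_option synthInstance.maxHeartbeats 200000 in
/-- Exactness at order `0` on the slab: the deviation vanishes at slab points. [folklore] -/
theorem deviation_eq_zero_of_truncDeviationCk_le_zero {𝒮 : Spacetime.{0} 4} {B : ModelBackground}
    {Φ₀ : B.domain → 𝒮.carrier} {k : ℕ} {R τ : ℝ} (h : 𝒮.truncDeviationCk B Φ₀ k R τ ≤ 0)
    {x : B.domain} (hx : x ∈ B.truncTimeSlab R τ) : 𝒮.deviation B Φ₀ x = 0 := by
  have hle := (enorm_iteratedFDeriv_le_supCkENorm (k := k) (m := 0) (Nat.zero_le _)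
    (mem_image_of_mem Subtype.val hx) (𝒮.deviationExtend B Φ₀)).trans h
  have h0 : iteratedFDeriv ℝ 0 (𝒮.deviationExtend B Φ₀) x.1 = 0 := by
    have := le_antisymm hle zero_le
    rwa [enorm_eq_zero] at this
  have h1 := congrArg (fun F => F Fin.elim0) h0
  simp only [iteratedFDeriv_zero_apply, Spacetime.deviationExtend_coe] at h1
  exact h1

end Shared

/-! ### (A1): the factorisation through the Cauchy hypersurface -/

set_option maxHeartbeats 1600000 in
/-- **(A1) `slabFactorisation_holds`** (step (a)): `Φ₀ ∘ (y ↦ Λ(0,y) + c)` is a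
smooth map of the open slab into `𝒱` with image in `ι(X)`, hence factors smoothly through the
embedding `ι` (`Literature.Geometry.Manifold.exists_contMDiff_comp_eq_of_range_subset`); the
factor has injective differentials (`dΦ₀` is injective at slab points by order-`0` exactness and
the nondegeneracy of `g_{M,a}`), is injective, and is a local diffeomorphism
(`isLocalDiffeomorphAt_of_mfderiv`), hence an open embedding. [cite: LeeSmoothManifolds2013, Cor. 5.30] -/
theorem slabFactorisation_holds :
    ∀ (k' : ℕ) (X : Type) [TopologicalSpace X] [ChartedSpace E3 X] [IsManifold (𝓡 3) ∞ X]
        [T2Space X] [SecondCountableTopology X] [ConnectedSpace X]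
        (D : InitialDataSet (𝓡 3) X) (𝒱 : VacuumCauchyDevelopment D)
        (M a : ℝ) (mo : lorentzGroup × E4) (B : ModelBackground) (Φ₀ : B.domain → 𝒱.carrier),
      0 < M → |a| < M →
      B = starBackground mo.1 mo.2 M a (fun x => Kerr.radius a (poincareInv mo.1 mo.2 x)) →
      (ContMDiffOn 𝓘(ℝ, E4) (𝓡 4) ∞ Φ₀
          {x | -1 < B.time x.1 ∧ B.time x.1 < 1 ∧ B.radius x.1 < 3 * M + 1} ∧
        IsOpenEmbedding ({x | -1 < B.time x.1 ∧ B.time x.1 < 1 ∧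
          B.radius x.1 < 3 * M + 1}.restrict Φ₀)) →
      𝒱.toSpacetime.truncDeviationCk B Φ₀ k' (3 * M) 0 ≤ 0 →
      Φ₀ '' B.truncTimeSlab (3 * M) 0 ⊆ range 𝒱.embed →
      ∃ ΦN : slabW M a → X, ContMDiff (𝓡 3) (𝓡 3) ((((⊤ : ℕ∞) : WithTop ℕ∞)) + 1) ΦN ∧
        (∀ u, Injective (mfderiv (𝓡 3) (𝓡 3) ΦN u)) ∧ IsOpenEmbedding ΦN ∧
        (∀ y : slabW M a, ∃ hx : ((mo.1 : E4 ≃L[ℝ] E4) (E4.ofTimeSpace 0 (y : E3)) + mo.2) ∈ B.domain,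
            𝒱.embed (ΦN y) = Φ₀ ⟨_, hx⟩) := by
  intro k' X _ _ _ _ _ _ D 𝒱 M a mo B Φ₀ hM ha hB hΦ hdev hslab
  set P : E4 → E4 := poincareInv mo.1 mo.2 with hP
  have hdom : (B.domain : Set E4) = P ⁻¹' (Kerr.region a M : Set E4) := by rw [hB]; rfl
  have htime : B.time = fun x => P x 0 := by rw [hB]; rfl
  have hrad : B.radius = fun x => Kerr.radius a (P x) := by rw [hB]; rfl
  have hbil : B.bilin = boostedKerrBilin mo.1 mo.2 M a := by rw [hB]; rfl
  have hPreg : ∀ x : B.domain, P x.1 ∈ Kerr.region a M := fun x => by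
    have hx : (x.1 : E4) ∈ (B.domain : Set E4) := x.2
    rw [hdom] at hx
    exact hx
  -- the affine representative `A z = Λ (0, z) + c` and the lab-frame slab embedding `eN`
  set A : E3 → E4 := fun z => (mo.1 : E4 ≃L[ℝ] E4) (E4.ofTimeSpace 0 z) + mo.2 with hA
  have hPA : ∀ z, P (A z) = E4.ofTimeSpace 0 z := fun z => poincareInv_lab mo _
  have hAd : ∀ z, HasFDerivAt A (((mo.1 : E4 ≃L[ℝ] E4) : E4 →L[ℝ] E4).comp E4.spaceEmbed) z :=
    fun z => (((mo.1 : E4 ≃L[ℝ] E4) : E4 →L[ℝ] E4).hasFDerivAt.comp z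
      (E4.hasFDerivAt_ofTimeSpace 0 z)).add_const mo.2
  have hAs : ContDiff ℝ ∞ A :=
    (((mo.1 : E4 ≃L[ℝ] E4) : E4 →L[ℝ] E4).contDiff.comp (E4.contDiff_ofTimeSpace 0)).add
      contDiff_const
  have hAinj : Injective A := fun z₁ z₂ h => by
    have := congrArg P h
    rw [hPA, hPA] at this
    exact E4.ofTimeSpace_injective 0 this
  have hmem : ∀ y : slabW M a, A (y : E3) ∈ B.domain := fun y => by
    show A (y : E3) ∈ (B.domain : Set E4)
    rw [hdom, mem_preimage, hPA]
    exact Kerr.mem_slice_iff_ofTimeSpace_mem_region.1 y.1.2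
  set eN : slabW M a → B.domain := fun y => ⟨A (y : E3), hmem y⟩ with heN
  have heNs : ContMDiff 𝓘(ℝ, E3) 𝓘(ℝ, E4) ∞ eN := by
    rw [← ContMDiff.subtypeVal_comp_iff]
    exact (hAs.contMDiff.comp contMDiff_subtype_val).comp contMDiff_subtype_val
  have hdeN : ∀ y : slabW M a, mfderiv 𝓘(ℝ, E3) 𝓘(ℝ, E4) eN y =
      (((mo.1 : E4 ≃L[ℝ] E4) : E4 →L[ℝ] E4).comp E4.spaceEmbed) := by
    intro y
    have hdAz : MDifferentiableAt 𝓘(ℝ, E3) 𝓘(ℝ, E4) (fun z : Kerr.slice a M => A z.1) y.1 :=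
      ((hAs.contMDiff.comp contMDiff_subtype_val) y.1).mdifferentiableAt (by simp)
    have hd1 : MDifferentiableAt 𝓘(ℝ, E3) 𝓘(ℝ, E4) (fun y : slabW M a => A (y : E3)) y :=
      (((hAs.contMDiff.comp contMDiff_subtype_val).comp contMDiff_subtype_val) y).mdifferentiableAt
        (by simp)
    rw [OpensChart.mfderiv_codRestrict (f := fun y : slabW M a => A (y : E3)) (fun _ => rfl) hd1,
      show (fun y : slabW M a => A (y : E3)) = (fun z : Kerr.slice a M => A z.1) ∘ Subtype.val from rfl,
      mfderiv_comp_subtypeVal hdAz,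
      show (fun z : Kerr.slice a M => A z.1) = A ∘ Subtype.val from rfl,
      mfderiv_comp_subtypeVal (hAs.contMDiff.contMDiffAt.mdifferentiableAt (by simp)),
      mfderiv_eq_fderiv, (hAd _).fderiv]
  -- `eN` lands in the layer and in the closed slab
  have hslabmem : ∀ y : slabW M a, eN y ∈ B.truncTimeSlab (3 * M) 0 := fun y => by
    refine ⟨?_, ?_⟩
    · rw [htime]; show P (A _) 0 = 0; rw [hPA]; rfl
    · rw [hrad]; show Kerr.radius a (P (A _)) ≤ 3 * M; rw [hPA]; exact y.2.le
  have hlayer : ∀ y : slabW M a, eN y ∈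
      {x : B.domain | -1 < B.time x.1 ∧ B.time x.1 < 1 ∧ B.radius x.1 < 3 * M + 1} := fun y => by
    obtain ⟨h0, hr⟩ := hslabmem y
    exact ⟨by rw [h0]; norm_num, by rw [h0]; norm_num, by linarith⟩
  -- the smooth map `Φ₀ ∘ eN` into `𝒱`, with image in `ι(X)`, and its factorisation
  have hg : ContMDiff 𝓘(ℝ, E3) (𝓡 4) ∞ (Φ₀ ∘ eN) := hΦ.1.comp_contMDiff heNs hlayer
  have hrange : range (Φ₀ ∘ eN) ⊆ range 𝒱.embed := by
    rintro _ ⟨y, rfl⟩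
    exact hslab ⟨eN y, hslabmem y, rfl⟩
  obtain ⟨ΦN, hΦNs, hcomp⟩ :=
    Literature.Geometry.Manifold.exists_contMDiff_comp_eq_of_range_subset 𝒱.isSmoothEmbedding hg hrange
  have hΦNd : ∀ u, MDifferentiableAt (𝓡 3) (𝓡 3) ΦN u := fun u => (hΦNs u).mdifferentiableAt (by simp)
  have hLo : IsOpen {x : B.domain | -1 < B.time x.1 ∧ B.time x.1 < 1 ∧ B.radius x.1 < 3 * M + 1} := by
    have ht : Continuous fun x : B.domain => B.time x.1 := by
      rw [htime]
      exact ((PiLp.continuous_apply 2 _ 0).comp (continuous_poincareInv _ _)).comp continuous_subtype_val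
    have hr : Continuous fun x : B.domain => B.radius x.1 := by
      rw [hrad]
      exact ((Kerr.continuous_radius a).comp (continuous_poincareInv _ _)).comp continuous_subtype_val
    simp only [Set.setOf_and]
    exact (isOpen_lt continuous_const ht).inter ((isOpen_lt ht continuous_const).inter
      (isOpen_lt hr continuous_const))
  have hΦ₀d : ∀ y : slabW M a, MDifferentiableAt 𝓘(ℝ, E4) (𝓡 4) Φ₀ (eN y) := fun y =>
    ((hΦ.1 _ (hlayer y)).contMDiffAt (hLo.mem_nhds (hlayer y))).mdifferentiableAt (by simp)
  -- `dΦ₀` is injective at slab points (order-`0` exactness + nondegeneracy of `g_{M,a}`)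
  have hinjΦ₀ : ∀ x ∈ B.truncTimeSlab (3 * M) 0, Injective (mfderiv 𝓘(ℝ, E4) (𝓡 4) Φ₀ x) := by
    intro x hx v₁ v₂ hv
    have hdev0 := deviation_eq_zero_of_truncDeviationCk_le_zero hdev hx
    have hiso : ∀ v w : E4, 𝒱.metric.val (Φ₀ x) (mfderiv 𝓘(ℝ, E4) (𝓡 4) Φ₀ x v)
        (mfderiv 𝓘(ℝ, E4) (𝓡 4) Φ₀ x w) = B.bilin x.1 v w := fun v w => by
      have h := congrArg (fun b => b v w) hdev0
      simp only [Spacetime.deviation_apply, zero_apply, sub_eq_zero] at h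
      exact h
    set u := v₁ - v₂ with hu
    have hu0 : mfderiv 𝓘(ℝ, E4) (𝓡 4) Φ₀ x u = 0 := by rw [hu, map_sub, hv, sub_self]
    have key : ∀ w' : E4,
        Kerr.bilin M a (poincareInv mo.1 mo.2 x.1) (((mo.1 : E4 ≃L[ℝ] E4).symm) u) w' = 0 := by
      intro w'
      have h := hiso u ((mo.1 : E4 ≃L[ℝ] E4) w')
      rw [hu0, map_zero, zero_apply, hbil, boostedKerrBilin_apply,
        ContinuousLinearEquiv.symm_apply_apply] at h
      exact h.symm
    have hsu : ((mo.1 : E4 ≃L[ℝ] E4).symm) u = 0 :=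
      Kerr.bilin_nondegenerate M a (Kerr.radius_pos_of_mem_region (hPreg x)) _ key
    have hu' := congrArg (mo.1 : E4 ≃L[ℝ] E4) hsu
    simp only [ContinuousLinearEquiv.apply_symm_apply, map_zero] at hu'
    rw [hu] at hu'
    exact sub_eq_zero.mp hu'
  -- the differentials of `Φ_N` are injective
  have hΦN' : ∀ u, Injective (mfderiv (𝓡 3) (𝓡 3) ΦN u) := by
    intro y v₁ v₂ hv
    have h1 : mfderiv 𝓘(ℝ, E3) (𝓡 4) (𝒱.embed ∘ ΦN) y =
        (mfderiv (𝓡 3) (𝓡 4) 𝒱.embed (ΦN y)).comp (mfderiv (𝓡 3) (𝓡 3) ΦN y) :=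
      mfderiv_comp y (𝒱.mdifferentiable_embed _) (hΦNd y)
    have h2 : mfderiv 𝓘(ℝ, E3) (𝓡 4) (Φ₀ ∘ eN) y =
        (mfderiv 𝓘(ℝ, E4) (𝓡 4) Φ₀ (eN y)).comp (mfderiv 𝓘(ℝ, E3) 𝓘(ℝ, E4) eN y) :=
      mfderiv_comp y (hΦ₀d y) (heNs.mdifferentiableAt (by simp))
    rw [hcomp, h2, hdeN y] at h1
    have h3 : mfderiv 𝓘(ℝ, E4) (𝓡 4) Φ₀ (eN y) ((((mo.1 : E4 ≃L[ℝ] E4) : E4 →L[ℝ] E4).comp E4.spaceEmbed) v₁) =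
        mfderiv 𝓘(ℝ, E4) (𝓡 4) Φ₀ (eN y) ((((mo.1 : E4 ≃L[ℝ] E4) : E4 →L[ℝ] E4).comp E4.spaceEmbed) v₂) := by
      have e1 : mfderiv 𝓘(ℝ, E4) (𝓡 4) Φ₀ (eN y)
          ((((mo.1 : E4 ≃L[ℝ] E4) : E4 →L[ℝ] E4).comp E4.spaceEmbed) v₁) =
          mfderiv (𝓡 3) (𝓡 4) 𝒱.embed (ΦN y) (mfderiv (𝓡 3) (𝓡 3) ΦN y v₁) :=
        DFunLike.congr_fun h1 v₁
      have e2 : mfderiv 𝓘(ℝ, E4) (𝓡 4) Φ₀ (eN y)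
          ((((mo.1 : E4 ≃L[ℝ] E4) : E4 →L[ℝ] E4).comp E4.spaceEmbed) v₂) =
          mfderiv (𝓡 3) (𝓡 4) 𝒱.embed (ΦN y) (mfderiv (𝓡 3) (𝓡 3) ΦN y v₂) :=
        DFunLike.congr_fun h1 v₂
      rw [e1, e2, hv]
    have h4 : (((mo.1 : E4 ≃L[ℝ] E4) : E4 →L[ℝ] E4).comp E4.spaceEmbed) v₁ =
        (((mo.1 : E4 ≃L[ℝ] E4) : E4 →L[ℝ] E4).comp E4.spaceEmbed) v₂ :=
      hinjΦ₀ (eN y) (hslabmem y) h3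
    have h5 : E4.spaceEmbed v₁ = E4.spaceEmbed v₂ := by
      simpa using h4
    have h6 := congrArg E4.spatial h5
    simp only [E4.spatial_spaceEmbed] at h6
    exact h6
  -- `Φ_N` is injective
  have hΦNinj : Injective ΦN := by
    intro y₁ y₂ h
    have h1 : Φ₀ (eN y₁) = Φ₀ (eN y₂) := by
      have e₁ := congrFun hcomp y₁; have e₂ := congrFun hcomp y₂
      simp only [Function.comp_apply] at e₁ e₂
      rw [← e₁, ← e₂, h]
    have h2 : eN y₁ = eN y₂ := by
      have := hΦ.2.injective (a₁ := ⟨eN y₁, hlayer y₁⟩) (a₂ := ⟨eN y₂, hlayer y₂⟩) h1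
      exact congrArg Subtype.val this
    have h3 : A (y₁ : E3) = A (y₂ : E3) := congrArg Subtype.val h2
    exact Subtype.ext (Subtype.ext (hAinj h3))
  -- `Φ_N` is a local diffeomorphism, hence an open embedding
  have hloc : IsLocalDiffeomorph (𝓡 3) (𝓡 3) ∞ ΦN := fun y => by
    set L : E3 →L[ℝ] E3 := mfderiv (𝓡 3) (𝓡 3) ΦN y with hL
    have hLinj : Injective L := hΦN' y
    refine Literature.Geometry.Manifold.isLocalDiffeomorphAt_of_mfderiv (n := ∞) (by simp) isOpen_univ
      (mem_univ y) hΦNs.contMDiffOn (L.toLinearMap.linearEquivOfInjective hLinj rfl).toContinuousLinearEquiv ?_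
    ext v
    show L v = (L.toLinearMap.linearEquivOfInjective hLinj rfl).toContinuousLinearEquiv v
    rw [LinearEquiv.coe_toContinuousLinearEquiv', LinearMap.linearEquivOfInjective_apply]
    rfl
  have hΦNo : IsOpenEmbedding ΦN :=
    IsOpenEmbedding.of_continuous_injective_isOpenMap hΦNs.continuous hΦNinj hloc.isOpenMap
  refine ⟨ΦN, hΦNs, hΦN', hΦNo, fun y => ⟨hmem y, ?_⟩⟩
  exact congrFun hcomp y

end F1Route

open F1Route in
/-- **Registered bookkeeping sub-goal `stub_slabFactorisation` of the line** (brick of the landing of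
F1' `stub_slabCauchyRigidity'`): (A1) — on the thick slab of an exact collar chart `Φ₀` of a maximal
vacuum development, `Φ₀ ∘ (y ↦ Λ(0,y) + c)` factors through the Cauchy hypersurface as `ι ∘ Φ_N` with
`Φ_N` a smooth open embedding of the open slab with injective differentials.
[cite: LeeSmoothManifolds2013, Cor. 5.30] -/
theorem stub_slabFactorisation :
    ∀ (k' : ℕ) (X : Type) [TopologicalSpace X] [ChartedSpace E3 X] [IsManifold (𝓡 3) ∞ X]
      [T2Space X] [SecondCountableTopology X] [ConnectedSpace X]
      (D : InitialDataSet (𝓡 3) X) (𝒱 : VacuumCauchyDevelopment D)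
      (M a : ℝ) (mo : lorentzGroup × E4) (B : ModelBackground) (Φ₀ : B.domain → 𝒱.carrier),
    0 < M → |a| < M →
    B = starBackground mo.1 mo.2 M a (fun x => Kerr.radius a (poincareInv mo.1 mo.2 x)) →
    (ContMDiffOn 𝓘(ℝ, E4) (𝓡 4) ∞ Φ₀
        {x | -1 < B.time x.1 ∧ B.time x.1 < 1 ∧ B.radius x.1 < 3 * M + 1} ∧
      IsOpenEmbedding ({x | -1 < B.time x.1 ∧ B.time x.1 < 1 ∧
        B.radius x.1 < 3 * M + 1}.restrict Φ₀)) →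
    𝒱.toSpacetime.truncDeviationCk B Φ₀ k' (3 * M) 0 ≤ 0 →
    Φ₀ '' B.truncTimeSlab (3 * M) 0 ⊆ range 𝒱.embed →
    ∃ ΦN : F1Route.slabW M a → X, ContMDiff (𝓡 3) (𝓡 3) ((((⊤ : ℕ∞) : WithTop ℕ∞)) + 1) ΦN ∧
      (∀ u, Injective (mfderiv (𝓡 3) (𝓡 3) ΦN u)) ∧ IsOpenEmbedding ΦN ∧
      (∀ y : F1Route.slabW M a,
        ∃ hx : ((mo.1 : E4 ≃L[ℝ] E4) (E4.ofTimeSpace 0 (y : E3)) + mo.2) ∈ B.domain,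
          𝒱.embed (ΦN y) = Φ₀ ⟨_, hx⟩) :=
  slabFactorisation_holds

end Summit.FinalStateConjecture.FinalStateConjecture.Theorems.BondiBartnikRigidity.DirectMethod

end
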